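import Literature.Analysis.Complex.BochnerTubeFourier
import Mathlib.Analysis.Normed.Module.Convex
import Mathlib.Analysis.SpecialFunctions.Trigonometric.DerivHyp
import HarnessLib

/-!
# Bochner's tube theorem for functions of exponential growth in the real directions

Analysis/Complex support file (everything proved; no definitions, no named facts), sequel of
`BochnerTubeFourier`. The tree's Bochner theorem
(`exists_holomorphic_extension_tube_convexHull`) asks the holomorphic function `F` on the tube
`T(B) = ℝᵏ + iB` to be **bounded** on `ℝᵏ + iK` for every compact `K ⊆ B`, uniformly in the real
directions. In the Osterwalder–Schrader continuation (Comm. Math. Phys. 42 (1975), Ch. V, (5.22):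
"the regions `C_k^{(N)}` and `D_n^{(N)}` are mapped onto tubular domains under the transformation
`ζᵢ = e^{wᵢ}`") the functions are the Schwinger functions in the *logarithmic* coordinates
`w = u + iv = log ζ`, which grow like a power of `|ζᵢ| + 1/Re ζᵢ`, i.e. **exponentially in `u`**,
locally uniformly in `v` — so the bounded version does not apply as it stands. Here is the form
that does, and which reproduces its own hypothesis (so that it can be iterated along the induction
(A_N)):

* `exists_holomorphic_extension_tube_convexHull_of_expGrowth` — let `B ⊆ ℝᵏ` be open, bounded and
  star-shaped with respect to `0 ∈ B`, `F` holomorphic on `T(B)` with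
  `‖F(x + iy)‖ ≤ C_K e^{a‖x‖}` for `y` in any compact `K ⊆ B` (one rate `a`, constants `C_K`).
  Then `F` extends to a holomorphic function on `T(conv B)` with the same kind of bound (some rate
  `a'`, constants depending on the compact `K' ⊆ conv B`), equal to `F` on `T(B)` and unique.

Proof: divide by the entire, zero-free-on-the-tube damping factor `E(w) = ∏ᵢ cosh(c wᵢ)^M` with
`c = 1/(R+1)`, `R ⊇ ‖conv B‖`, and `M ≥ a (R+1)`: since `|cosh(c(x + iy))| ≥ cosh(cx) cos(cy) ≥
(cos 1/2) e^{c|x|}` for `|cy| ≤ 1`, the quotient `F/E` is bounded on every `ℝᵏ + iK`, the bounded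
theorem extends it, and multiplying back by `E` (`|cosh(c wᵢ)| ≤ e^{c|xᵢ|}`) gives the extension
of `F` with rate `a' = c k M`. (Classical statement without any growth hypothesis: Bochner 1938,
Hörmander *SCV* Thm. 2.5.10; this file only removes the boundedness restriction of the Fourier
proof in the direction needed by OS II.)

## References

* S. Bochner, *A theorem on analytic continuation of functions in several variables*, Ann. Math.
  39 (1938) 14–19.
* K. Osterwalder, R. Schrader, *Axioms for Euclidean Green's functions II*, Comm. Math. Phys. 42
  (1975) 281–305, Ch. V (5.8), (5.22)–(5.23); Ch. VI (6.13)–(6.15). [OsterwalderSchraderCMP1975]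
-/

noncomputable section

open _root_.Complex Set Filter Metric Real
open scoped _root_.Topology

namespace Literature.Analysis.Complex

open TubeFourier

variable {k : ℕ}

/-! ### Elementary estimates for `cosh` -/

/-- `Re cosh(a + ib) = cosh a · cos b`. [folklore] -/
theorem re_cosh_ofReal_add_mul_I (a b : ℝ) :
    (Complex.cosh (a + b * I)).re = Real.cosh a * Real.cos b := by
  rw [Complex.cosh_add, Complex.cosh_mul_I, Complex.sinh_mul_I]
  simp [Complex.add_re, Complex.mul_re, Complex.mul_im, Complex.I_re, Complex.I_im,
    Complex.cosh_ofReal_re, Complex.cos_ofReal_re, Complex.cosh_ofReal_im, Complex.cos_ofReal_im,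
    Complex.sinh_ofReal_im, Complex.sin_ofReal_im]

/-- `e^{|a|}/2 ≤ cosh a`. [folklore] -/
theorem half_exp_abs_le_cosh (a : ℝ) : Real.exp |a| / 2 ≤ Real.cosh a := by
  rw [← Real.cosh_abs, Real.cosh_eq]
  have := Real.exp_pos (-|a|)
  linarith

/-- **Lower bound**: `cosh(a) cos(b) ≤ |cosh(a + ib)|` (for `cos b ≥ 0` this is the useful
direction). [folklore] -/
theorem cosh_mul_cos_le_norm_cosh (a b : ℝ) :
    Real.cosh a * Real.cos b ≤ ‖Complex.cosh (a + b * I)‖ := by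
  rw [← re_cosh_ofReal_add_mul_I]
  exact (le_abs_self _).trans (Complex.abs_re_le_norm _)

/-- **Upper bound**: `|cosh z| ≤ e^{|Re z|}`. [folklore] -/
theorem norm_cosh_le_exp_abs_re (z : ℂ) : ‖Complex.cosh z‖ ≤ Real.exp |z.re| := by
  rw [Complex.cosh]
  have h1 : ‖Complex.exp z‖ ≤ Real.exp |z.re| := by
    rw [Complex.norm_exp]; exact Real.exp_le_exp.2 (le_abs_self _)
  have h2 : ‖Complex.exp (-z)‖ ≤ Real.exp |z.re| := by
    rw [Complex.norm_exp, Complex.neg_re]; exact Real.exp_le_exp.2 (neg_le_abs _)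
  calc ‖(Complex.exp z + Complex.exp (-z)) / 2‖ = ‖Complex.exp z + Complex.exp (-z)‖ / 2 := by
        rw [norm_div]; norm_num
    _ ≤ (‖Complex.exp z‖ + ‖Complex.exp (-z)‖) / 2 := by gcongr; exact norm_add_le _ _
    _ ≤ Real.exp |z.re| := by linarith

/-- For `|b| ≤ 1`: `(cos 1 / 2) e^{|a|} ≤ |cosh(a + ib)|`, in particular `cosh(a + ib) ≠ 0`. [folklore] -/
theorem cos_one_half_exp_le_norm_cosh {a b : ℝ} (hb : |b| ≤ 1) :
    Real.cos 1 / 2 * Real.exp |a| ≤ ‖Complex.cosh (a + b * I)‖ := by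
  have hcos : Real.cos 1 ≤ Real.cos b := by
    rw [← Real.cos_abs b]
    exact Real.cos_le_cos_of_nonneg_of_le_pi (abs_nonneg b)
      (by linarith [Real.two_le_pi]) hb
  have hc1 : 0 < Real.cos 1 := Real.cos_one_pos
  calc Real.cos 1 / 2 * Real.exp |a| = Real.exp |a| / 2 * Real.cos 1 := by ring
    _ ≤ Real.cosh a * Real.cos b :=
        mul_le_mul (half_exp_abs_le_cosh a) hcos hc1.le (Real.cosh_pos a).le
    _ ≤ ‖Complex.cosh (a + b * I)‖ := cosh_mul_cos_le_norm_cosh a b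

/-! ### Norms on `ℝᵏ` -/

/-- `|xᵢ| ≤ ‖x‖` in Euclidean space. [folklore] -/
theorem abs_apply_le_norm_euclidean (x : EuclideanSpace ℝ (Fin k)) (i : Fin k) : |x i| ≤ ‖x‖ := by
  simpa using PiLp.norm_apply_le x i

/-- `‖x‖ ≤ ∑ᵢ |xᵢ|` in Euclidean space. [folklore] -/
theorem norm_le_sum_abs_euclidean (x : EuclideanSpace ℝ (Fin k)) : ‖x‖ ≤ ∑ i, |x i| := by
  have hsq : ‖x‖ ^ 2 ≤ (∑ i, |x i|) ^ 2 := by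
    rw [EuclideanSpace.norm_eq, Real.sq_sqrt (Finset.sum_nonneg fun i _ => sq_nonneg _), sq,
      Finset.sum_mul_sum]
    refine Finset.sum_le_sum fun i _ => ?_
    rw [Real.norm_eq_abs, sq]
    exact Finset.single_le_sum (f := fun j => |x i| * |x j|)
      (fun j _ => mul_nonneg (abs_nonneg _) (abs_nonneg _)) (Finset.mem_univ i)
  exact (pow_le_pow_iff_left₀ (norm_nonneg _) (Finset.sum_nonneg fun i _ => abs_nonneg _)
    two_ne_zero).1 hsq

/-! ### The theorem -/

/-- **Bochner's tube theorem under exponential growth in the real directions.** Let `B ⊆ ℝᵏ`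
be open, bounded and star-shaped with respect to `0 ∈ B`, and let `F` be holomorphic on the tube
`T(B)` with `‖F(x + iy)‖ ≤ C_K e^{a‖x‖}` for every compact `K ⊆ B` (one rate `a`). Then `F`
extends to a function holomorphic on `T(conv B)`, equal to `F` on `T(B)`, satisfying the same
kind of bound on `T(K')` for every compact `K' ⊆ conv B` (one rate `a'`), and unique among
holomorphic extensions. (The form of Bochner's theorem needed along the Osterwalder–Schrader
induction in the logarithmic variables, OS II (5.22)–(5.23); module docstring.) [folklore] -/
theorem exists_holomorphic_extension_tube_convexHull_of_expGrowth {B : Set (EuclideanSpace ℝ (Fin k))} (hBo : IsOpen B)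
    (h0 : (0 : EuclideanSpace ℝ (Fin k)) ∈ B) (hst : StarConvex ℝ 0 B) (hBb : Bornology.IsBounded B)
    {F : (Fin k → ℂ) → ℂ} (hFd : DifferentiableOn ℂ F (tube B))
    (hgr : ∃ a : ℝ, ∀ K ⊆ B, IsCompact K → ∃ C : ℝ, ∀ x, ∀ y ∈ K,
      ‖F (cpt x y)‖ ≤ C * Real.exp (a * ‖x‖)) :
    ∃ Fext : (Fin k → ℂ) → ℂ,
      DifferentiableOn ℂ Fext (tube (convexHull ℝ B)) ∧ EqOn Fext F (tube B) ∧
      (∃ a' : ℝ, ∀ K ⊆ convexHull ℝ B, IsCompact K → ∃ C : ℝ, ∀ x, ∀ y ∈ K,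
        ‖Fext (cpt x y)‖ ≤ C * Real.exp (a' * ‖x‖)) ∧
      ∀ G : (Fin k → ℂ) → ℂ, DifferentiableOn ℂ G (tube (convexHull ℝ B)) →
        EqOn G F (tube B) → EqOn G Fext (tube (convexHull ℝ B)) := by
  classical
  obtain ⟨a, ha⟩ := hgr
  -- a radius for the convex hull, the damping rate `c` and exponent `M`
  obtain ⟨R, hR⟩ := (isBounded_convexHull.2 hBb).exists_norm_le
  set R' : ℝ := max R 0 + 1 with hR'
  have hR'pos : 0 < R' := by have := le_max_right R 0; rw [hR']; linarith
  have hRR' : R ≤ R' := by have := le_max_left R 0; rw [hR']; linarith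
  set c : ℝ := 1 / R' with hc
  have hc0 : 0 < c := by rw [hc]; positivity
  have hcy : ∀ y ∈ convexHull ℝ B, ∀ i, |c * y i| ≤ 1 := by
    intro y hy i
    rw [abs_mul, abs_of_pos hc0]
    have h1 : |y i| ≤ R' := (abs_apply_le_norm_euclidean y i).trans ((hR y hy).trans hRR')
    calc c * |y i| ≤ c * R' := by gcongr
      _ = 1 := by rw [hc]; field_simp
  set ap : ℝ := max a 0 with hap
  have hap0 : 0 ≤ ap := le_max_right _ _
  set M : ℕ := ⌈ap * R'⌉₊ with hM
  have hcM : ap ≤ c * M := by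
    have h1 : ap * R' ≤ M := Nat.le_ceil _
    rw [hc, div_mul_eq_mul_div, one_mul, le_div_iff₀ hR'pos]
    exact h1
  have hcM0 : 0 ≤ c * M := by positivity
  -- the damping factor `E(w) = ∏ cosh(c wᵢ)^M`
  set E : (Fin k → ℂ) → ℂ := fun w => ∏ i, Complex.cosh (c * w i) ^ M with hE
  have hEi : ∀ i, Differentiable ℂ fun w : Fin k → ℂ => Complex.cosh (c * w i) ^ M := fun i =>
    (Complex.differentiable_cosh.comp ((differentiable_apply i).const_mul (c : ℂ))).pow M
  have hEd : Differentiable ℂ E := fun w =>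
    (HasFDerivAt.finsetProd (u := Finset.univ)
      (fun i _ => ((hEi i) w).hasFDerivAt)).differentiableAt
  have hccpt : ∀ (x y : EuclideanSpace ℝ (Fin k)) (i : Fin k), (c : ℂ) * cpt x y i = ((c * x i : ℝ) : ℂ) + ((c * y i : ℝ) : ℂ) * I := by
    intro x y i; simp only [cpt_apply]; push_cast; ring
  -- lower bound on the tube over the hull
  set A : ℝ := (Real.cos 1 / 2) ^ (M * k) with hA
  have hA0 : 0 < A := by have := Real.cos_one_pos; positivity
  have hElow : ∀ x, ∀ y ∈ convexHull ℝ B, A * Real.exp (c * M * ‖x‖) ≤ ‖E (cpt x y)‖ := by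
    intro x y hy
    have hfac : ∀ i, (Real.cos 1 / 2) ^ M * Real.exp (c * M * |x i|) ≤
        ‖Complex.cosh (c * cpt x y i) ^ M‖ := by
      intro i
      rw [norm_pow, hccpt, show c * M * |x i| = (M : ℝ) * |c * x i| by
        rw [abs_mul, abs_of_pos hc0]; ring, Real.exp_nat_mul, ← mul_pow]
      exact pow_le_pow_left₀ (by have := Real.cos_one_pos; positivity)
        (cos_one_half_exp_le_norm_cosh (hcy y hy i)) M
    have hprod : ∏ i, (Real.cos 1 / 2) ^ M * Real.exp (c * M * |x i|) ≤ ‖E (cpt x y)‖ := by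
      rw [hE]
      simp only [norm_prod]
      exact Finset.prod_le_prod (fun i _ => by have := Real.cos_one_pos; positivity) fun i _ => hfac i
    refine le_trans ?_ hprod
    rw [Finset.prod_mul_distrib, Finset.prod_const, Finset.card_univ, Fintype.card_fin, ← pow_mul,
      ← Real.exp_sum, ← Finset.mul_sum]
    gcongr
    exact norm_le_sum_abs_euclidean x
  have hE0 : ∀ w ∈ tube (convexHull ℝ B), E w ≠ 0 := by
    intro w hw h
    have h1 := hElow (rev w) (imv w) hw
    rw [cpt_rev_imv, h, norm_zero] at h1
    have : 0 < A * Real.exp (c * M * ‖rev w‖) := by positivity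
    linarith
  -- upper bound everywhere
  have hEup : ∀ x y : EuclideanSpace ℝ (Fin k), ‖E (cpt x y)‖ ≤ Real.exp (c * M * k * ‖x‖) := by
    intro x y
    have hfac : ∀ i, ‖Complex.cosh (c * cpt x y i) ^ M‖ ≤ Real.exp (c * ‖x‖) ^ M := by
      intro i
      rw [norm_pow]
      refine pow_le_pow_left₀ (norm_nonneg _) ((norm_cosh_le_exp_abs_re _).trans ?_) M
      rw [hccpt]
      simp only [Complex.add_re, Complex.ofReal_re, Complex.mul_re, Complex.I_re, Complex.I_im,
        Complex.ofReal_im, mul_zero, zero_mul, sub_zero, add_zero]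
      rw [abs_mul, abs_of_pos hc0]
      exact Real.exp_le_exp.2 (mul_le_mul_of_nonneg_left (abs_apply_le_norm_euclidean x i) hc0.le)
    calc ‖E (cpt x y)‖ = ∏ i, ‖Complex.cosh (c * cpt x y i) ^ M‖ := by rw [hE]; simp only [norm_prod]
      _ ≤ ∏ _i : Fin k, Real.exp (c * ‖x‖) ^ M := Finset.prod_le_prod (fun i _ => norm_nonneg _) fun i _ => hfac i
      _ = Real.exp (c * M * k * ‖x‖) := by
          rw [Finset.prod_const, Finset.card_univ, Fintype.card_fin, ← pow_mul, ← Real.exp_nat_mul]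
          congr 1; push_cast; ring
  -- the damped function and its bounds
  set G : (Fin k → ℂ) → ℂ := fun w => F w * (E w)⁻¹ with hG
  have hBsub : tube B ⊆ tube (convexHull ℝ B) := tube_mono (subset_convexHull ℝ B)
  have hGd : DifferentiableOn ℂ G (tube B) :=
    hFd.mul (hEd.differentiableOn.inv fun w hw => hE0 w (hBsub hw))
  have hGb : ∀ K ⊆ B, IsCompact K → ∃ M₁ : ℝ, ∀ x, ∀ y ∈ K, ‖G (cpt x y)‖ ≤ M₁ := by
    intro K hKB hKc
    obtain ⟨C, hC⟩ := ha K hKB hKc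
    refine ⟨max C 0 / A, fun x y hy => ?_⟩
    have hyc : y ∈ convexHull ℝ B := subset_convexHull ℝ B (hKB hy)
    have hEpos : 0 < ‖E (cpt x y)‖ := lt_of_lt_of_le (by positivity) (hElow x y hyc)
    rw [hG, norm_mul, norm_inv, ← div_eq_mul_inv, div_le_iff₀ hEpos]
    calc ‖F (cpt x y)‖ ≤ C * Real.exp (a * ‖x‖) := hC x y hy
      _ ≤ max C 0 * Real.exp (ap * ‖x‖) := by
          refine le_trans ?_ (mul_le_mul_of_nonneg_left (Real.exp_le_exp.2
            (mul_le_mul_of_nonneg_right (le_max_left a 0) (norm_nonneg x))) (le_max_right C 0))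
          exact mul_le_mul_of_nonneg_right (le_max_left C 0) (Real.exp_pos _).le
      _ ≤ max C 0 * Real.exp (c * M * ‖x‖) := by gcongr
      _ = max C 0 / A * (A * Real.exp (c * M * ‖x‖)) := by field_simp
      _ ≤ max C 0 / A * ‖E (cpt x y)‖ :=
          mul_le_mul_of_nonneg_left (hElow x y hyc) (by positivity)
  -- Bochner for the damped function
  obtain ⟨Gext, hGext_d, hGext_eq, hGext_bd, hGext_uniq⟩ :=
    exists_holomorphic_extension_tube_convexHull hBo h0 hst hGd hGb
  refine ⟨fun w => Gext w * E w, hGext_d.mul hEd.differentiableOn, ?_, ?_, ?_⟩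
  · intro w hw
    show Gext w * E w = F w
    rw [hGext_eq hw, hG]
    exact inv_mul_cancel_right₀ (hE0 w (hBsub hw)) (F w)
  · refine ⟨c * M * k, fun K hK hKc => ?_⟩
    obtain ⟨M', hM'⟩ := hGext_bd K hK hKc
    refine ⟨max M' 0, fun x y hy => ?_⟩
    rw [norm_mul]
    calc ‖Gext (cpt x y)‖ * ‖E (cpt x y)‖ ≤ max M' 0 * Real.exp (c * M * k * ‖x‖) :=
          mul_le_mul ((hM' _ (by rw [imv_cpt]; exact hy)).trans (le_max_left _ _)) (hEup x y)
            (norm_nonneg _) (le_max_right _ _)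
      _ = max M' 0 * Real.exp (c * M * k * ‖x‖) := rfl
  · intro G' hG'd hG'eq w hw
    have hq : EqOn (fun w => G' w * (E w)⁻¹) Gext (tube (convexHull ℝ B)) :=
      hGext_uniq _ (hG'd.mul (hEd.differentiableOn.inv hE0)) fun u hu => by
        show G' u * (E u)⁻¹ = G u
        rw [hG'eq hu]
    show G' w = Gext w * E w
    rw [← hq hw]
    exact (inv_mul_cancel_right₀ (hE0 w hw) (G' w)).symm

end Literature.Analysis.Complex
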